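import Literature.GroupTheory.TwoSheetDegenerate
import HarnessLib

/-!
# The two-sheet degeneracy lemma WITH BALANCE: the annihilator of a singular odd block has zero sums along every
# subset of the abelian sheet on which the character sums to zero

COR-CM (cell `pub-hodgecm2`), binder seat b04 (gen 41), count-neutral own lane «Galois-CM-type classification».  Pure
finite-group harmonic analysis (Mathlib + the seat's `CorCM/TwoSheetDegenerate`): theorems, no definition, no named fact, no
`sorry`.  `HC_CM` is neither used nor claimed.

SETTING of `CorCM/TwoSheetAnnihilator` / `CorCM/TwoSheetDegenerate` (gens 20, 28): `i : A →* G` injective from a finite ABELIAN group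
with image of index two, `G = i(A) ⊔ i(A)x`, `x i(u) x⁻¹ = i(θu)`, `x² = i(q)`, `c ∈ A` with `θc = c`; `S ⊆ G` with sheets `S₁`, `S₂`;
an ODD character `χ` (`χ(c) = −1`) with a SINGULAR block `Ŝ₁(χ)Ŝ₁(χθ) − χ(q)Ŝ₂(χ)Ŝ₂(χθ) = 0`.  Gen 28 produced a non-zero
`i(c)`-antisymmetric rational weight `b` annihilated by the right translates of `S`.  HERE the same weight is shown to be BALANCED
over every finite `N ⊆ A` with `Σ_{n∈N} χ(n) = 0`: `Σ_{n∈N} b(g·i(n)) = 0` for all `g ∈ G` (the weight is a pure mode `aχ` on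
`i(A)` and `b(χ∘θ)` on `i(A)x`, so its sums along `g·i(N)` are multiples of `Σ_N χ`).  For the two-sheet groups `Q_{4m} × C_p`,
`C_p ⋊ C_{2ⁿ}` and `N = C_p` this is the input of the WEIGHT form of gen 39's certificate lift along subgroups
(`CorCM/GaloisWeightCertificateLift`): a character identity on a subgroup `H₀ ∋ c` of `Gal(K/ℚ)` makes `K` BAD.

* `exists_complex_annihilator_of_det_eq_zero_balanced`, `exists_rat_annihilator_of_complex_balanced`,
  **`exists_annihilator_of_det_eq_zero_balanced`** (group form).

## References

* [Kubota1965] T. Kubota, *On the field extension by complex multiplication*, Trans. AMS 118 (1965), §4 Lemma 2.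
* [Dodson1987] B. Dodson, J. Algebra 111 (1987), §1.1 p. 50 (the rank via translates).
* [Gordon1999HodgeAVSurvey] B. B. Gordon, *A survey of the Hodge conjecture for abelian varieties*, Prop. 9.4.1, §9.4.

Provenance: Literature home (namespace `Literature.GroupTheory.TwoSheet`) of the Summits-side `CorCM/TwoSheetDegenerateBalanced` (cell `pub-hodgecm2`, COR-CM; all its imports are `Literature/`, Mathlib and the already re-homed `TwoSheetDegenerate`), which `Literature/` may not import; theorems only, no named fact, no definition. Nothing here bears on `HC_CM`. Lane `lit-hodgefound` (Layer A3: CM types, their Kubota ranks and Galois combinatorics), seat p20.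
-/

noncomputable section

open scoped BigOperators

namespace Literature.GroupTheory.TwoSheet

open AddChar

variable {A : Type*} [CommGroup A] [Fintype A] [DecidableEq A]

/-! ## §1 Descent `ℂ → ℚ` keeping the balance -/

omit [Fintype A] [DecidableEq A] in
/-- **Rational descent of a balanced complex annihilator.**  A non-zero `c`-antisymmetric complex weight annihilated by the right
translates of `S` and with zero sums along the sets `g·i(N)` yields a rational one with the same three properties (compose with a
`ℚ`-linear functional `ℂ → ℚ` not vanishing at one non-zero value). [cite: Kubota1965, §4 Lemma 2] -/
theorem exists_rat_annihilator_of_complex_balanced {G : Type*} [Group G] (S : Finset G) (c : G) (bC : G → ℂ) (g₀ : G)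
    (h0 : bC g₀ ≠ 0) (hanti : ∀ g, bC (c * g) = -bC g) (hann : ∀ g, ∑ s ∈ S, bC (s * g) = 0)
    (i : A →* G) (N : Finset A) (hbal : ∀ g, ∑ n ∈ N, bC (g * i n) = 0) :
    ∃ b : G → ℚ, b g₀ ≠ 0 ∧ (∀ g, b (c * g) = -b g) ∧ (∀ g, ∑ s ∈ S, b (s * g) = 0) ∧
      ∀ g, ∑ n ∈ N, b (g * i n) = 0 := by
  obtain ⟨f, hf⟩ := Module.Projective.exists_dual_ne_zero ℚ h0
  refine ⟨fun g => f (bC g), hf, fun g => ?_, fun g => ?_, fun g => ?_⟩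
  · show f (bC (c * g)) = -f (bC g)
    rw [hanti, map_neg]
  · show ∑ s ∈ S, f (bC (s * g)) = 0
    rw [← map_sum, hann, map_zero]
  · show ∑ n ∈ N, f (bC (g * i n)) = 0
    rw [← map_sum, hbal, map_zero]

/-! ## §2 The complex annihilator of a singular odd block is balanced -/

section Group

variable {G : Type*} [Group G] [Fintype G] [DecidableEq G]

omit [DecidableEq A] [DecidableEq G] in
/-- **The complex annihilator of a singular odd block, with balance.**  As `TwoSheet.exists_complex_annihilator_of_det_eq_zero`
(the weight `b_ℂ(i u) = a χ(u)`, `b_ℂ(i(u) x) = b χ(θ u)` of a non-zero kernel vector `(a, b)` of the singular `2 × 2` block is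
`i(c)`-antisymmetric, annihilated and non-zero), and moreover `Σ_{n∈N} b_ℂ(g·i(n)) = 0` for every `g` and every finite `N ⊆ A` with
`Σ_{n∈N} χ(n) = 0`. [cite: Kubota1965, §4 Lemma 2] [cite: Dodson1987, §1.1 (p. 50)] -/
theorem exists_complex_annihilator_of_det_eq_zero_balanced (i : A →* G) (hi : Function.Injective i) (x : G)
    (hx : ∀ u, i u ≠ x) (hcov : ∀ g : G, (∃ u, g = i u) ∨ (∃ u, g = i u * x)) (θ : A ≃* A)
    (hθ : ∀ u, x * i u = i (θ u) * x) (q : A) (hq : x * x = i q) {c : A} (hθc : θ c = c)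
    (S : Finset G) (S₁ S₂ : Finset A) (hS₁ : ∀ u, u ∈ S₁ ↔ i u ∈ S) (hS₂ : ∀ u, u ∈ S₂ ↔ i u * x ∈ S)
    (χ : AddChar (Additive A) ℂ) (hχ : χ (Additive.ofMul c) = -1)
    (hΔ : (∑ s ∈ S₁, χ (Additive.ofMul s)) * (∑ s ∈ S₁, χ (Additive.ofMul (θ s))) -
        χ (Additive.ofMul q) * ((∑ t ∈ S₂, χ (Additive.ofMul t)) * (∑ t ∈ S₂, χ (Additive.ofMul (θ t)))) = 0)
    (N : Finset A) (hN : ∑ n ∈ N, χ (Additive.ofMul n) = 0) :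
    ∃ (bC : G → ℂ) (g₀ : G), bC g₀ ≠ 0 ∧ (∀ g, bC (i c * g) = -bC g) ∧ (∀ g : G, ∑ s ∈ S, bC (s * g) = 0) ∧
      ∀ g : G, ∑ n ∈ N, bC (g * i n) = 0 := by
  classical
  have hθθ := twist_twist i hi x θ hθ q hq
  obtain ⟨a, b, hab, E1, E2⟩ := exists_kernel_of_det_eq_zero (∑ s ∈ S₁, χ (Additive.ofMul s))
    (χ (Additive.ofMul q) * ∑ t ∈ S₂, χ (Additive.ofMul t)) (∑ t ∈ S₂, χ (Additive.ofMul (θ t)))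
    (∑ s ∈ S₁, χ (Additive.ofMul (θ s))) (by linear_combination hΔ)
  obtain ⟨h1, h2⟩ := twoSheet_modes θ hθθ S₁ S₂ χ a b E1 E2
  -- the decomposition `G = i(A) ⊔ i(A) x` as a definition by cases
  have hdec : ∀ g : G, ¬ (∃ u, g = i u) → ∃ u, g = i u * x := fun g h => (hcov g).resolve_left h
  let bC : G → ℂ := fun g =>
    if h : ∃ u, g = i u then a * χ (Additive.ofMul h.choose) else b * χ (Additive.ofMul (θ (hdec g h).choose))
  have hnot : ∀ u, ¬ ∃ u', i u * x = i u' := fun u ⟨u', hu'⟩ =>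
    hx (u⁻¹ * u') (by rw [map_mul, map_inv, ← hu', inv_mul_cancel_left])
  have hbC1 : ∀ u, bC (i u) = a * χ (Additive.ofMul u) := fun u => by
    have h : ∃ u', i u = i u' := ⟨u, rfl⟩
    simp only [bC, dif_pos h]
    rw [← hi h.choose_spec]
  have hbC2 : ∀ u, bC (i u * x) = b * χ (Additive.ofMul (θ u)) := fun u => by
    simp only [bC, dif_neg (hnot u)]
    rw [← hi (mul_right_cancel (hdec _ (hnot u)).choose_spec)]
  refine ⟨bC, if a ≠ 0 then i 1 else i 1 * x, ?_, ?_, ?_, ?_⟩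
  · -- non-zero: `b_ℂ(i 1) = a`, `b_ℂ(i(1) x) = b`
    split_ifs with ha
    · rwa [hbC1, ofMul_one, map_zero_eq_one, mul_one]
    · push Not at ha
      rw [hbC2, map_one, ofMul_one, map_zero_eq_one, mul_one]
      exact hab.resolve_left (not_not.2 ha)
  · -- antisymmetric
    intro g
    rcases hcov g with ⟨w, rfl⟩ | ⟨w, rfl⟩
    · rw [← map_mul, hbC1, hbC1, ofMul_mul, map_add_eq_mul, hχ]; ring
    · rw [← mul_assoc, ← map_mul, hbC2, hbC2, map_mul, hθc, ofMul_mul, map_add_eq_mul, hχ]; ring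
  · -- annihilated
    intro g
    rw [sum_eq_sum_sheets i hi x hx hcov S S₁ S₂ hS₁ hS₂ (fun s => bC (s * g))]
    rcases hcov g with ⟨w, rfl⟩ | ⟨w, rfl⟩
    · have e1 : ∀ u, i u * i w = i (u * w) := fun u => by rw [map_mul]
      have e2 : ∀ u, i u * x * i w = i (u * θ w) * x := fun u => by rw [mul_assoc, hθ, map_mul, mul_assoc]
      simp only [e1, e2, hbC1, hbC2]
      exact h1 w
    · have e1 : ∀ u, i u * (i w * x) = i (u * w) * x := fun u => by rw [map_mul, mul_assoc]
      have e2 : ∀ u, i u * x * (i w * x) = i (u * (q * θ w)) := fun u => by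
        calc i u * x * (i w * x) = i u * (x * i w) * x := by simp only [mul_assoc]
          _ = i u * (i (θ w) * x) * x := by rw [hθ]
          _ = i u * (i (θ w) * (x * x)) := by simp only [mul_assoc]
          _ = i (u * (q * θ w)) := by rw [hq, ← map_mul i (θ w) q, ← map_mul, mul_comm (θ w) q]
      simp only [e1, e2, hbC1, hbC2]
      have h := h2 (θ w)
      simp only [hθθ] at h
      exact h
  · -- balanced over `N`: pure modes have sums `(a χ(w) or b χ(θ w)) · Σ_N χ = 0` along `g · i(N)`
    intro g
    rcases hcov g with ⟨w, rfl⟩ | ⟨w, rfl⟩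
    · have e1 : ∀ n, bC (i w * i n) = a * (χ (Additive.ofMul w) * χ (Additive.ofMul n)) := fun n => by
        rw [← map_mul, hbC1, ofMul_mul, map_add_eq_mul]
      simp only [e1]
      calc ∑ n ∈ N, a * (χ (Additive.ofMul w) * χ (Additive.ofMul n))
          = a * χ (Additive.ofMul w) * ∑ n ∈ N, χ (Additive.ofMul n) := by
            rw [Finset.mul_sum]; exact Finset.sum_congr rfl fun n _ => by ring
        _ = 0 := by rw [hN, mul_zero]
    · have e1 : ∀ n, bC (i w * x * i n) = b * (χ (Additive.ofMul (θ w)) * χ (Additive.ofMul n)) := fun n => by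
        rw [mul_assoc, hθ, ← mul_assoc, ← map_mul, hbC2, map_mul, hθθ, ofMul_mul, map_add_eq_mul]
      simp only [e1]
      calc ∑ n ∈ N, b * (χ (Additive.ofMul (θ w)) * χ (Additive.ofMul n))
          = b * χ (Additive.ofMul (θ w)) * ∑ n ∈ N, χ (Additive.ofMul n) := by
            rw [Finset.mul_sum]; exact Finset.sum_congr rfl fun n _ => by ring
        _ = 0 := by rw [hN, mul_zero]

omit [DecidableEq A] [DecidableEq G] in
/-- **THE TWO-SHEET DEGENERACY THEOREM WITH BALANCE (group form).**  In the setting of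
`TwoSheet.exists_annihilator_of_det_eq_zero` (a singular ODD two-sheet block at `χ`), there is a NON-ZERO `i(c)`-antisymmetric
`b : G → ℚ` annihilated by all right translates of `S` AND with `Σ_{n∈N} b(g·i(n)) = 0` for every `g ∈ G`, for any finite `N ⊆ A`
with `Σ_{n∈N} χ(n) = 0` (e.g. a subgroup of `A` on which `χ` is non-trivial).  With the weight form of the certificate lift
(`CorCM/GaloisWeightCertificateLift`) a singular block on a subgroup `H₀ ∋ c` of `Gal(K/ℚ)` containing a normal `N` makes `K` BAD.
[cite: Kubota1965, §4 Lemma 2] [cite: Dodson1987, §1.1 (p. 50)] -/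
theorem exists_annihilator_of_det_eq_zero_balanced (i : A →* G) (hi : Function.Injective i) (x : G) (hx : ∀ u, i u ≠ x)
    (hcov : ∀ g : G, (∃ u, g = i u) ∨ (∃ u, g = i u * x)) (θ : A ≃* A) (hθ : ∀ u, x * i u = i (θ u) * x)
    (q : A) (hq : x * x = i q) {c : A} (hθc : θ c = c)
    (S : Finset G) (S₁ S₂ : Finset A) (hS₁ : ∀ u, u ∈ S₁ ↔ i u ∈ S) (hS₂ : ∀ u, u ∈ S₂ ↔ i u * x ∈ S)
    (χ : AddChar (Additive A) ℂ) (hχ : χ (Additive.ofMul c) = -1)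
    (hΔ : (∑ s ∈ S₁, χ (Additive.ofMul s)) * (∑ s ∈ S₁, χ (Additive.ofMul (θ s))) -
        χ (Additive.ofMul q) * ((∑ t ∈ S₂, χ (Additive.ofMul t)) * (∑ t ∈ S₂, χ (Additive.ofMul (θ t)))) = 0)
    (N : Finset A) (hN : ∑ n ∈ N, χ (Additive.ofMul n) = 0) :
    ∃ b : G → ℚ, b ≠ 0 ∧ (∀ g, b (i c * g) = -b g) ∧ (∀ g : G, ∑ s ∈ S, b (s * g) = 0) ∧
      ∀ g : G, ∑ n ∈ N, b (g * i n) = 0 := by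
  obtain ⟨bC, g₀, h0, hanti, hann, hbal⟩ :=
    exists_complex_annihilator_of_det_eq_zero_balanced i hi x hx hcov θ hθ q hq hθc S S₁ S₂ hS₁ hS₂ χ hχ hΔ N hN
  obtain ⟨b, hb0, hb, hbann, hbbal⟩ := exists_rat_annihilator_of_complex_balanced S (i c) bC g₀ h0 hanti hann i N hbal
  exact ⟨b, fun h => hb0 (by rw [h]; rfl), hb, hbann, hbbal⟩

end Group

end Literature.GroupTheory.TwoSheet

end
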